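import Summits.BirchSwinnertonDyer.BirchSwinnertonDyer.Theses.TwoAdicConverse
import Summits.BirchSwinnertonDyer.BirchSwinnertonDyer.Theorems.TwoAdicConverseGoodOrdAutomaticAtTwo
import Literature.NumberTheory.EllipticCurves.PrimeConductorTorsionLValue
import Literature.NumberTheory.EllipticCurves.TwoAdicImageQuadraticTwistProofs
import Literature.NumberTheory.EllipticCurves.HeightConductorBoundsModularityProofs
import Literature.NumberTheory.EllipticCurves.ModularityVersionApProofs
import Literature.NumberTheory.EllipticCurves.BSDSelmerCMPConverseProofs
import Literature.NumberTheory.EllipticCurves.PrimeConductorTwoTorsionProofs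
import HarnessLib

/-!
# Route `TwoAdicConverse` (rung S3), item 19218 `GoodOrdinaryRankZeroTwoConverse` — the PRIME-CONDUCTOR corner of
# stratum (β): for `X₀(17)` and every Neumann–Setzer curve (`N = u² + 64` prime, rational `2`-torsion) the S3
# statements hold from PRINT, by Mazur's winding isomorphism at the `2`-Eisenstein prime (*Eisenstein ideal* II (18.10))

Cell `bsd-2adic`, seat `bsd-2adic-conv-1` (GEN 23). THEOREMS ONLY — no definition, no `sorry`; ONE new named fact is
consumed BY NAME as a displayed hypothesis (`hMz :
Literature.NumberTheory.EllipticCurves.Mazur1977_entireLFunction_one_ne_zero_of_prime_conductor_of_two_torsion`,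
file `Literature/NumberTheory/EllipticCurves/PrimeConductorTorsionLValue.lean`), next to the route's PUBLISHED inputs
modularity (`hmod : nonempty_modularParametrizationData`, the first conjunct of item 19167
`OrdConversePublishedInputsAtTwo`) and Kato Cor. 14.3 at `p = 2` (`hK : kato_finite_of_L_one_ne_zero · 2`).

HONEST FRAMING. The crux of 19218 (λ-half 19556 `OrdLambdaHalfAtTwo`) is untouched. What this file records is that on ONE
explicit infinite-in-principle family inside the hardest stratum (β) = «`E(ℚ)[2] ≠ 0`» — the curves of PRIME conductor
with a rational point of order `2`, i.e. `X₀(17)`'s class and the Neumann–Setzer pairs `N = u² + 64` (Setzer 1975, tree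
theorem `Setzer1975_primeConductor_rationalTwoTorsion_holds`) — the CONCLUSION `r_an = 0` of the rank-`0` `2`-converse
is a theorem IN PRINT: Mazur's Thm. II (18.10) says the winding homomorphism `e₊ : 𝔍_𝔓 → H⁺_𝔓` is an isomorphism at EVERY
Eisenstein prime `𝔓` of `J₀(N)`, `N` prime, INCLUDING `p = 2` ("the new information conveyed by (18.10) is for `p = 2`"),
so the winding element has a non-zero component on every newform through `𝔓 = (𝔍, 2)`; a rational `2`-torsion point
puts `f_E` there (`a_ℓ ≡ 1 + ℓ (mod 2)`), hence `L(E, 1) ≠ 0`. This is an «Eisenstein-ideal argument at `p = 2`» that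
DOES reach an `L`-value — at prime level, where `𝕋_𝔓` is Gorenstein (Mazur II §16) — recorded for the pen against the
route's `why it might fail` («every printed Eisenstein-congruence argument needs `p` odd»): the obstruction is the
level, not the prime. So on this family 19218 holds with its Selmer hypothesis IDLE, and with Kato 14.3 the whole S3 leaf
`NonCMTwoConverse` holds (`corank_{ℤ₂} Sel_{2^∞} = 0 = r_an`; the `r = 1` case is vacuous). The family is thin
(conjecturally infinite: Hardy–Littlewood for `u² + 64`), it is NOT a route item, nothing is booked (D-0054), and BSD is
not proved by any of this. PARTITION (D-0054): none — RANK axis (S3) × X5@2 good-ordinary (β) rows of PRIME conductor;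
types-the-object-of.

* §1 `entireLFunction_one_ne_zero_of_prime_conductorNorm_of_hasRationalTwoTorsionX` (`L(E,1) ≠ 0` ⟸ hMz + hmod),
  `analyticRank_eq_zero_of_prime_conductorNorm_of_hasRationalTwoTorsionX`.
* §2 the family lies INSIDE 19218's habitat: `hasGoodReductionAtPrime_two_of_prime_conductorNorm` (`N ≥ 11` from
  modularity, tree `eleven_le_conductorNorm_of_modularity`; so `2 ∤ N`), `goodOrd_two_of_prime_conductorNorm_of_hasRationalTwoTorsionX`
  (GEN 22's `goodOrd_two_of_good_of_hasRationalTwoTorsionX`: good + rational `2`-torsion ⇒ ordinary).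
* §3 Selmer side: `selmerCorank_two_eq_zero_of_prime_conductorNorm_of_hasRationalTwoTorsionX` (Kato 14.3 at `2`).
* §4 the S3 statements on the family: `analyticRank_eq_selmerCorank_two_of_prime_conductorNorm_of_hasRationalTwoTorsionX`
  (`r_an = corank`, both `0`), `goodOrdinaryRankZeroTwoConverse_on_prime_conductorNorm_of_hasRationalTwoTorsionX` (19218's
  shape restricted), `nonCMTwoConverse_on_prime_conductorNorm_of_hasRationalTwoTorsionX` (the leaf's shape restricted, `r ≤ 1`).
* §5 Setzer normal form of the family (`conductorNorm_eq_seventeen_or_sq_add_sixty_four`, from the tree theorem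
  `Setzer1975_primeConductor_rationalTwoTorsion_holds`): `N = 17` or `N = u² + 64`; and `r_an = 0` read on the
  Neumann–Setzer models `E₀(u)`, `E₁(u)` (`analyticRank_eq_zero_of_smul_eq_neumannSetzerCurve₀/₁`).

References: [Mazur1977] II (9.7), (18.6), Thm. (18.10) + Remark (p. 139), III Prop. (7.4) (ii); [Kato2004Asterisque]
Cor. 14.3; [BCDTJAMS2001] Thm. A; [Setzer1975]; [SteinWatkins2004] §4.3 («Neumann–Setzer curves have rank 0»).
-/

set_option linter.dupNamespace false
set_option autoImplicit false

noncomputable section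

open scoped Classical
open WeierstrassCurve Literature.NumberTheory.EllipticCurves Literature.NumberTheory.EllipticCurves.ModularForms
  Literature.NumberTheory.EllipticCurves.Greenberg1999 Literature.NumberTheory.EllipticCurves.Rank1Residual
  Summit.BirchSwinnertonDyer.BirchSwinnertonDyer.Theses.TwoAdicConverse

namespace Summit.BirchSwinnertonDyer.BirchSwinnertonDyer.Theorems.TwoAdicPrimeConductor

variable (W : WeierstrassCurve ℚ) [W.IsElliptic] [W.IsGloballyMinimal]

/-! ## §1. `L(E, 1) ≠ 0` and `r_an = 0` on the prime-conductor `2`-torsion family -/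

/-- **`L(E,1) ≠ 0` for prime conductor + a rational point of order `2`** (`X₀(17)`, Neumann–Setzer curves), from
Mazur's winding isomorphism at the `2`-Eisenstein prime (named fact `hMz`, [Mazur1977] II Thm. (18.10)) and
modularity (`hmod`, the newform `D.f` of a parametrisation datum at level `N_W`).
[cite: Mazur1977, II Thm. (18.10) and Remark (p. 139); III Prop. (7.4) (ii) (p. 163)] [cite: BCDTJAMS2001, Thm. A] -/
theorem entireLFunction_one_ne_zero_of_prime_conductorNorm_of_hasRationalTwoTorsionX
    (hMz : Mazur1977_entireLFunction_one_ne_zero_of_prime_conductor_of_two_torsion)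
    (hmod : nonempty_modularParametrizationData) (hN : (W.conductorNorm ℤ).Prime) {x : ℚ}
    (hx : HasRationalTwoTorsionX W x) : W.entireLFunction 1 ≠ 0 := by
  haveI : NeZero (W.conductorNorm ℤ) := ⟨hN.ne_zero⟩
  obtain ⟨D⟩ := hmod W
  exact hMz W hN ⟨D.f, D.isNewformOf⟩ ((exists_two_torsion_iff_exists_hasRationalTwoTorsionX' W).mpr ⟨x, hx⟩)

/-- **`r_an(E) = 0` for prime conductor + a rational point of order `2`**: `ord_{s=1} L(E,s) = 0` from `L(E,1) ≠ 0`
(the order of vanishing of a germ with non-zero value is `0`). [cite: Mazur1977, II Thm. (18.10) (p. 139)]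
[cite: BCDTJAMS2001, Thm. A] -/
theorem analyticRank_eq_zero_of_prime_conductorNorm_of_hasRationalTwoTorsionX
    (hMz : Mazur1977_entireLFunction_one_ne_zero_of_prime_conductor_of_two_torsion)
    (hmod : nonempty_modularParametrizationData) (hN : (W.conductorNorm ℤ).Prime) {x : ℚ}
    (hx : HasRationalTwoTorsionX W x) : W.analyticRank = 0 :=
  Literature.NumberTheory.EllipticCurves.analyticRank_eq_zero_of_entireLFunction_one_ne_zero W
    (entireLFunction_one_ne_zero_of_prime_conductorNorm_of_hasRationalTwoTorsionX W hMz hmod hN hx)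

/-! ## §2. The family lies inside 19218's habitat: good ORDINARY reduction at `2` -/

omit [W.IsGloballyMinimal] in
/-- A curve of prime conductor has good reduction at `2`: modularity forces `N_W ≥ 11`
(`eleven_le_conductorNorm_of_modularity`: the levels `≤ 10` have genus `0`), so the prime `N_W` is odd and `2 ∤ N_W`
means good reduction at `2` (`dvd_conductorNorm_iff_not_hasGoodReductionAtPrime`).
[cite: DiamondShurman2005, Thm. 3.5.1 and §8.3] [cite: BCDTJAMS2001, Thm. A] -/
theorem hasGoodReductionAtPrime_two_of_prime_conductorNorm (hmod : nonempty_modularParametrizationData)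
    (hN : (W.conductorNorm ℤ).Prime) : W.HasGoodReductionAtPrime 2 := by
  have h11 : 11 ≤ W.conductorNorm ℤ := eleven_le_conductorNorm_of_modularity hmod W
  have h2 : ¬ 2 ∣ W.conductorNorm ℤ := by
    intro h
    have := (Nat.prime_dvd_prime_iff_eq Nat.prime_two hN).mp h
    omega
  by_contra hbad
  exact h2 ((W.dvd_conductorNorm_iff_not_hasGoodReductionAtPrime 2).mpr hbad)

omit [W.IsGloballyMinimal] in
/-- Elementary form without modularity: an ODD prime conductor means good reduction at `2`.
[cite: DiamondShurman2005, §8.3 (PDF p. 353)] -/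
theorem hasGoodReductionAtPrime_two_of_odd_conductorNorm (hodd : Odd (W.conductorNorm ℤ)) :
    W.HasGoodReductionAtPrime 2 := by
  by_contra hbad
  exact (Nat.not_even_iff_odd.mpr hodd) (even_iff_two_dvd.mpr
    ((W.dvd_conductorNorm_iff_not_hasGoodReductionAtPrime 2).mpr hbad))

/-- **The family is good ORDINARY at `2`** (so it sits inside the habitat `GoodOrd W 2` of 19218 / 19556 / the S3 leaf):
good reduction at `2` (prime conductor `≥ 11`) and a rational point of order `2` force ordinarity — a good SUPERSINGULAR `2`
has `Δ_min ≡ 5 (mod 8)` and an irreducible `2`-division cubic over `ℚ₂` (GEN 22,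
`TwoAdicTwistConverse.goodOrd_two_of_good_of_hasRationalTwoTorsionX`). [cite: SilvermanAEC2009, V.4 and VII.2]
[cite: BCDTJAMS2001, Thm. A] -/
theorem goodOrd_two_of_prime_conductorNorm_of_hasRationalTwoTorsionX (hmod : nonempty_modularParametrizationData)
    (hN : (W.conductorNorm ℤ).Prime) {x : ℚ} (hx : HasRationalTwoTorsionX W x) : GoodOrd W 2 :=
  TwoAdicTwistConverse.goodOrd_two_of_good_of_hasRationalTwoTorsionX W
    (hasGoodReductionAtPrime_two_of_prime_conductorNorm W hmod hN) hx

/-! ## §3. Selmer side: `corank_{ℤ₂} Sel_{2^∞}(E/ℚ) = 0` (Kato Cor. 14.3 at `p = 2`) -/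

/-- **`corank_{ℤ₂} Sel_{2^∞}(E/ℚ) = 0` on the family**: `L(E,1) ≠ 0` (§1) and Kato's finiteness at `p = 2`
(`kato_finite_of_L_one_ne_zero W 2`: `Sel_{2^∞}(E/ℚ)` finite) give corank `0`
(`finite_selmerGroupPInfty_iff_selmerCorank_eq_zero`). [cite: Kato2004Asterisque, Cor. 14.3 (p. 235)]
[cite: Mazur1977, II Thm. (18.10) (p. 139)] -/
theorem selmerCorank_two_eq_zero_of_prime_conductorNorm_of_hasRationalTwoTorsionX
    (hMz : Mazur1977_entireLFunction_one_ne_zero_of_prime_conductor_of_two_torsion)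
    (hmod : nonempty_modularParametrizationData)
    (hK : ∀ (V : WeierstrassCurve ℚ) [V.IsElliptic] [V.IsGloballyMinimal], kato_finite_of_L_one_ne_zero V 2)
    (hN : (W.conductorNorm ℤ).Prime) {x : ℚ} (hx : HasRationalTwoTorsionX W x) : W.selmerCorank 2 = 0 := by
  haveI : Fact (Nat.Prime 2) := ⟨Nat.prime_two⟩
  obtain ⟨-, -, hfin⟩ :=
    hK W (entireLFunction_one_ne_zero_of_prime_conductorNorm_of_hasRationalTwoTorsionX W hMz hmod hN hx)
  exact (finite_selmerGroupPInfty_iff_selmerCorank_eq_zero W 2).mp hfin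

/-! ## §4. The S3 statements restricted to the family -/

/-- **`r_an = corank_{ℤ₂} Sel_{2^∞}` on the family** (both sides are `0`): the rank part of BSD at `2` in its
`2`-CONVERSE reading holds for `X₀(17)` and every Neumann–Setzer curve, from PRINT (Mazur + modularity + Kato).
[cite: Mazur1977, II Thm. (18.10) (p. 139)] [cite: Kato2004Asterisque, Cor. 14.3 (p. 235)] [cite: BCDTJAMS2001, Thm. A] -/
theorem analyticRank_eq_selmerCorank_two_of_prime_conductorNorm_of_hasRationalTwoTorsionX
    (hMz : Mazur1977_entireLFunction_one_ne_zero_of_prime_conductor_of_two_torsion)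
    (hmod : nonempty_modularParametrizationData)
    (hK : ∀ (V : WeierstrassCurve ℚ) [V.IsElliptic] [V.IsGloballyMinimal], kato_finite_of_L_one_ne_zero V 2)
    (hN : (W.conductorNorm ℤ).Prime) {x : ℚ} (hx : HasRationalTwoTorsionX W x) :
    W.analyticRank = W.selmerCorank 2 := by
  rw [analyticRank_eq_zero_of_prime_conductorNorm_of_hasRationalTwoTorsionX W hMz hmod hN hx,
    selmerCorank_two_eq_zero_of_prime_conductorNorm_of_hasRationalTwoTorsionX W hMz hmod hK hN hx]

/-- **Item 19218's statement RESTRICTED to prime conductor + rational `2`-torsion** holds from PRINT — the shape of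
`GoodOrdinaryRankZeroTwoConverse` with the two extra binders `(W.conductorNorm ℤ).Prime`, `∃ x, HasRationalTwoTorsionX W x`;
its hypotheses `¬ W.HasCM`, `GoodOrd W 2`, `W.selmerCorank 2 = 0` are IDLE here (the conclusion holds outright by §1;
`GoodOrd W 2` is even automatic, §2). Not the item: the ∀-crux over all good-ordinary non-CM curves stays OPEN.
[cite: Mazur1977, II Thm. (18.10) and Remark (p. 139)] [cite: BCDTJAMS2001, Thm. A] -/
theorem goodOrdinaryRankZeroTwoConverse_on_prime_conductorNorm_of_hasRationalTwoTorsionX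
    (hMz : Mazur1977_entireLFunction_one_ne_zero_of_prime_conductor_of_two_torsion)
    (hmod : nonempty_modularParametrizationData) :
    ∀ (W : WeierstrassCurve ℚ) [W.IsElliptic] [W.IsGloballyMinimal], ¬ W.HasCM → GoodOrd W 2 →
      (W.conductorNorm ℤ).Prime → (∃ x : ℚ, HasRationalTwoTorsionX W x) →
        W.selmerCorank 2 = 0 → W.analyticRank = 0 := by
  intro W _ _ _ _ hN hx _
  obtain ⟨x, hx⟩ := hx
  exact analyticRank_eq_zero_of_prime_conductorNorm_of_hasRationalTwoTorsionX W hMz hmod hN hx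

/-- **The S3 leaf `Rank1Residual.NonCMTwoConverse` RESTRICTED to prime conductor + rational `2`-torsion** holds from
PRINT (Mazur (18.10) + modularity + Kato 14.3 at `2`): for `r ≤ 1`, `corank_{ℤ₂} Sel_{2^∞}(E/ℚ) = r ⇒ r_an(E) = r` — at
`r = 0` by §1, and `r = 1` is vacuous since the corank is `0` (§3). The leaf's binders `¬ W.HasCM`,
`GoodOrd W 2 ∨ Mult W 2` are idle (and `GoodOrd W 2` holds, §2). Not the leaf: a thin family, nothing booked.
[cite: Mazur1977, II Thm. (18.10) (p. 139)] [cite: Kato2004Asterisque, Cor. 14.3 (p. 235)] [cite: BCDTJAMS2001, Thm. A] -/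
theorem nonCMTwoConverse_on_prime_conductorNorm_of_hasRationalTwoTorsionX
    (hMz : Mazur1977_entireLFunction_one_ne_zero_of_prime_conductor_of_two_torsion)
    (hmod : nonempty_modularParametrizationData)
    (hK : ∀ (V : WeierstrassCurve ℚ) [V.IsElliptic] [V.IsGloballyMinimal], kato_finite_of_L_one_ne_zero V 2) :
    ∀ (W : WeierstrassCurve ℚ) [W.IsElliptic] [W.IsGloballyMinimal], ¬ W.HasCM → (GoodOrd W 2 ∨ Mult W 2) →
      (W.conductorNorm ℤ).Prime → (∃ x : ℚ, HasRationalTwoTorsionX W x) →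
        ∀ r : ℕ, r ≤ 1 → W.selmerCorank 2 = r → W.analyticRank = r := by
  intro W _ _ _ _ hN hx r _ hr
  obtain ⟨x, hx⟩ := hx
  rw [← hr]
  exact analyticRank_eq_selmerCorank_two_of_prime_conductorNorm_of_hasRationalTwoTorsionX W hMz hmod hK hN hx

/-! ## §5. Setzer's normal form of the family -/

omit [W.IsGloballyMinimal] in
/-- **The family in Setzer's normal form** (unconditional: Setzer's theorem is the tree theorem
`Setzer1975_primeConductor_rationalTwoTorsion_holds`): prime conductor and a rational point of order `2` force `N = 17`
(the class of `X₀(17)`) or `N = u² + 64` with `u ≡ 3 (mod 4)` and `W ≅` one of the two Neumann–Setzer curves `E₀(u)`,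
`E₁(u)`. [cite: Setzer1975, pp. 367–378 (main theorem)] [cite: Mazur1977, III Prop. (7.4) (ii) (p. 163)] -/
theorem conductorNorm_eq_seventeen_or_sq_add_sixty_four (hN : (W.conductorNorm ℤ).Prime) {x : ℚ}
    (hx : HasRationalTwoTorsionX W x) :
    W.conductorNorm ℤ = 17 ∨ ∃ u : ℤ, u % 4 = 3 ∧ ((W.conductorNorm ℤ : ℕ) : ℤ) = u ^ 2 + 64 ∧
      ∃ C : WeierstrassCurve.VariableChange ℚ, C • W = neumannSetzerCurve₀ u ∨ C • W = neumannSetzerCurve₁ u :=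
  Setzer1975_primeConductor_rationalTwoTorsion_holds W x hx hN

/-- **`r_an = 0` read on any model**: a globally minimal `W` of prime conductor, `ℚ`-isomorphic (`C • W = V`) to a
model `V` carrying a rational point of order `2` with abscissa `x`, has `ord_{s=1} L(W,s) = 0` — the point is pulled
back along `C⁻¹` (tree `PrimeConductorTwoTorsion.hasRationalTwoTorsionX_smul`). [cite: Mazur1977, II Thm. (18.10) (p. 139)]
[cite: BCDTJAMS2001, Thm. A] -/
theorem analyticRank_eq_zero_of_prime_conductorNorm_of_smul_eq
    (hMz : Mazur1977_entireLFunction_one_ne_zero_of_prime_conductor_of_two_torsion)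
    (hmod : nonempty_modularParametrizationData) (hN : (W.conductorNorm ℤ).Prime)
    {V : WeierstrassCurve ℚ} (C : WeierstrassCurve.VariableChange ℚ) (hC : C • W = V) {x : ℚ}
    (hx : HasRationalTwoTorsionX V x) : W.analyticRank = 0 := by
  have h := PrimeConductorTwoTorsion.hasRationalTwoTorsionX_smul V C⁻¹ hx
  rw [← hC, inv_smul_smul] at h
  exact analyticRank_eq_zero_of_prime_conductorNorm_of_hasRationalTwoTorsionX W hMz hmod hN h

/-- **Neumann–Setzer curve `E₁(u)` (`y² + xy = x³ − (u+1)/4·x² − x`, `Δ = u² + 64`)**: every globally minimal `W` of prime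
conductor in its `ℚ`-isomorphism class has `r_an(W) = 0` (its point `(0, 0)` of order `2`: tree
`hasRationalTwoTorsionX_neumannSetzerCurve₁`). The conductor `u² + 64` itself is not computed in the tree, whence the
displayed binder `(W.conductorNorm ℤ).Prime`. [cite: Mazur1977, III §7 (p. 162) and II Thm. (18.10) (p. 139)]
[cite: SteinWatkins2004, §1 (PDF p. 3)] -/
theorem analyticRank_eq_zero_of_smul_eq_neumannSetzerCurve₁
    (hMz : Mazur1977_entireLFunction_one_ne_zero_of_prime_conductor_of_two_torsion)
    (hmod : nonempty_modularParametrizationData) (hN : (W.conductorNorm ℤ).Prime) {u : ℤ}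
    (C : WeierstrassCurve.VariableChange ℚ) (hC : C • W = neumannSetzerCurve₁ u) : W.analyticRank = 0 :=
  analyticRank_eq_zero_of_prime_conductorNorm_of_smul_eq W hMz hmod hN C hC
    (hasRationalTwoTorsionX_neumannSetzerCurve₁ u)

/-- **Neumann–Setzer curve `E₀(u)` (`y² + xy = x³ − (u+1)/4·x² + 4x − u`, `Δ = −(u² + 64)²`)**: every globally minimal
`W` of prime conductor in its `ℚ`-isomorphism class has `r_an(W) = 0` (its point `(u/4, −u/8)` of order `2`: tree
`hasRationalTwoTorsionX_neumannSetzerCurve₀`). [cite: Mazur1977, III §7 (p. 162) and II Thm. (18.10) (p. 139)]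
[cite: SteinWatkins2004, §1 (PDF p. 3)] -/
theorem analyticRank_eq_zero_of_smul_eq_neumannSetzerCurve₀
    (hMz : Mazur1977_entireLFunction_one_ne_zero_of_prime_conductor_of_two_torsion)
    (hmod : nonempty_modularParametrizationData) (hN : (W.conductorNorm ℤ).Prime) {u : ℤ}
    (C : WeierstrassCurve.VariableChange ℚ) (hC : C • W = neumannSetzerCurve₀ u) : W.analyticRank = 0 :=
  analyticRank_eq_zero_of_prime_conductorNorm_of_smul_eq W hMz hmod hN C hC
    (hasRationalTwoTorsionX_neumannSetzerCurve₀ u)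

end Summit.BirchSwinnertonDyer.BirchSwinnertonDyer.Theorems.TwoAdicPrimeConductor

end
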